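import Mathlib
import Summits.Ventures.HodgeRepro2.T5WedgeDet
import Summits.Ventures.HodgeRepro2.T5TopFormCharacter

/-!
# T5HodgeTypeCovectors — the `(p,q)`-types of 1- and 2-covectors on a split space and the
type of a wedge (N1 §ID-1, §ID-3(b), §ID-4(b))

Sub-step N1 of Tier 5 (route/T5-ID-p2.md) sorts the vertex classes by Hodge type (Theorem
ID(i): `v_a, v_b` of type `(1,0)`, `w_c, w_d` of type `(0,1)`; `ω_{ab} = v_a ∧ v_b` of type
`(2,0)`) and reads the `(p,q)`-decomposition of `(𝔤, K)`-cochains through Borel–Wallach II.4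
(3): `∧^n 𝔭^* = ⊕_{p+q=n} ∧^p(𝔭⁺)^* ⊗ ∧^q(𝔭⁻)^*`, a `(1,0)`-form being a `(𝔭⁺)^*`-valued
function and the wedge of two `(1,0)`-forms a `∧²(𝔭⁺)^*`-valued one (§ID-4(b)).

This file records the linear algebra of that sorting at the level of covectors on a space
`V` with a splitting `V = 𝔭⁺ ⊕ 𝔭⁻` given by an idempotent `p` (the projection onto `𝔭⁺`
along `𝔭⁻`; `q := 1 − p`):

* 1-covectors: `f` is of type `(1,0)` iff `f ∘ p = f` (it vanishes on `𝔭⁻`), of type `(0,1)`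
  iff `f ∘ q = f`; every `f` is `f ∘ p + f ∘ q` (`type10_add_type01`), uniquely;
* 2-covectors (`AlternatingMap`s on `Fin 2`): the three components `type20 ω = ω ∘ p`,
  `type02 ω = ω ∘ q`, `type11 ω = ω − type20 ω − type02 ω`; they have the stated types
  (`isType20_type20`, `isType02_type02`, `isType11_type11`), the decomposition is unique
  (`type20_eq_of_eq_add`, `type11_eq_of_eq_add`, `type02_eq_of_eq_add`), and the
  sum-decomposition `ω = type20 ω + type11 ω + type02 ω` holds by definition;
* **types add under the wedge** (in the vocabulary of `T5WedgeDet.wedge`):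
  `wedge_isType20` (two `(1,0)`-covectors wedge to a `(2,0)`-covector), `wedge_isType02`,
  `wedge_isType11` (a `(1,0)` and a `(0,1)` wedge to a `(1,1)`);
* in coordinates: a `(2,0)`-covector is determined by its restriction to `𝔭⁺`
  (`isType20_iff_forall`), it vanishes as soon as one argument lies in `𝔭⁻`
  (`IsType20.apply_eq_zero_of_mem_range_q`).

Nothing about manifolds, forms or cohomology is formalised: `V` is any vector space over a
field `K`, the splitting an idempotent endomorphism.
-/

namespace Summit.Ventures.HodgeRepro2.T5HodgeTypeCovectors

open Summit.Ventures.HodgeRepro2.T5WedgeDet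

variable {K : Type*} [Field K] {V : Type*} [AddCommGroup V] [Module K V]

/-! ## §1 The splitting -/

/-- The complementary projection `q = 1 − p`. -/
def q (p : V →ₗ[K] V) : V →ₗ[K] V := LinearMap.id - p

/-- `p + q = 1`. -/
theorem p_add_q (p : V →ₗ[K] V) : p + q p = LinearMap.id := by
  unfold q; abel

/-- `q` is idempotent when `p` is. -/
theorem q_comp_q (p : V →ₗ[K] V) (hp : p ∘ₗ p = p) : q p ∘ₗ q p = q p := by
  unfold q
  simp only [LinearMap.sub_comp, LinearMap.comp_sub, LinearMap.id_comp, LinearMap.comp_id, hp]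
  abel

/-- `p ∘ q = 0`. -/
theorem p_comp_q (p : V →ₗ[K] V) (hp : p ∘ₗ p = p) : p ∘ₗ q p = 0 := by
  unfold q
  simp only [LinearMap.comp_sub, LinearMap.comp_id, hp, sub_self]

/-- `q ∘ p = 0`. -/
theorem q_comp_p (p : V →ₗ[K] V) (hp : p ∘ₗ p = p) : q p ∘ₗ p = 0 := by
  unfold q
  simp only [LinearMap.sub_comp, LinearMap.id_comp, hp, sub_self]

/-- `q x = 0` for `x` in the range of `p` (a vector of `𝔭⁺`). -/
theorem q_apply_eq_zero_of_mem_range (p : V →ₗ[K] V) (hp : p ∘ₗ p = p) {x : V}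
    (hx : x ∈ LinearMap.range p) : q p x = 0 := by
  obtain ⟨y, rfl⟩ := hx
  rw [← LinearMap.comp_apply, q_comp_p p hp, LinearMap.zero_apply]

/-- `p x = 0` for `x` in the range of `q` (a vector of `𝔭⁻`). -/
theorem p_apply_eq_zero_of_mem_range_q (p : V →ₗ[K] V) (hp : p ∘ₗ p = p) {x : V}
    (hx : x ∈ LinearMap.range (q p)) : p x = 0 := by
  obtain ⟨y, rfl⟩ := hx
  rw [← LinearMap.comp_apply, p_comp_q p hp, LinearMap.zero_apply]

/-! ## §2 Types of 1-covectors -/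

/-- A covector is of type `(1,0)` for the splitting `p` iff it factors through `p`
(it vanishes on `𝔭⁻`). -/
def IsType10 (p : V →ₗ[K] V) (f : V →ₗ[K] K) : Prop := f ∘ₗ p = f

/-- A covector is of type `(0,1)` iff it factors through `q = 1 − p` (it vanishes on `𝔭⁺`). -/
def IsType01 (p : V →ₗ[K] V) (f : V →ₗ[K] K) : Prop := f ∘ₗ q p = f

/-- Every covector is the sum of its `(1,0)`- and `(0,1)`-components. -/
theorem type10_add_type01 (p : V →ₗ[K] V) (f : V →ₗ[K] K) : f ∘ₗ p + f ∘ₗ q p = f := by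
  rw [← LinearMap.comp_add, p_add_q, LinearMap.comp_id]

/-- `f ∘ p` is of type `(1,0)`. -/
theorem isType10_comp_p (p : V →ₗ[K] V) (hp : p ∘ₗ p = p) (f : V →ₗ[K] K) :
    IsType10 p (f ∘ₗ p) := by
  unfold IsType10
  rw [LinearMap.comp_assoc, hp]

/-- `f ∘ q` is of type `(0,1)`. -/
theorem isType01_comp_q (p : V →ₗ[K] V) (hp : p ∘ₗ p = p) (f : V →ₗ[K] K) :
    IsType01 p (f ∘ₗ q p) := by
  unfold IsType01
  rw [LinearMap.comp_assoc, q_comp_q p hp]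

/-- A `(1,0)`-covector vanishes on `𝔭⁻`. -/
theorem IsType10.apply_eq_zero (p : V →ₗ[K] V) (hp : p ∘ₗ p = p) {f : V →ₗ[K] K}
    (hf : IsType10 p f) {x : V} (hx : x ∈ LinearMap.range (q p)) : f x = 0 := by
  rw [← hf, LinearMap.comp_apply, p_apply_eq_zero_of_mem_range_q p hp hx, map_zero]

/-- A `(0,1)`-covector vanishes on `𝔭⁺`. -/
theorem IsType01.apply_eq_zero (p : V →ₗ[K] V) (hp : p ∘ₗ p = p) {f : V →ₗ[K] K}
    (hf : IsType01 p f) {x : V} (hx : x ∈ LinearMap.range p) : f x = 0 := by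
  rw [← hf, LinearMap.comp_apply, q_apply_eq_zero_of_mem_range p hp hx, map_zero]

/-- A covector of both types is zero: the decomposition of 1-covectors is unique. -/
theorem eq_zero_of_isType10_of_isType01 (p : V →ₗ[K] V) (hp : p ∘ₗ p = p) {f : V →ₗ[K] K}
    (h₁ : IsType10 p f) (h₂ : IsType01 p f) : f = 0 := by
  rw [← h₁, ← h₂, LinearMap.comp_assoc, q_comp_p p hp, LinearMap.comp_zero]

/-! ## §3 Types of 2-covectors -/

/-- The `(2,0)`-component of a 2-covector: `ω ∘ (p, p)`. -/
def type20 (p : V →ₗ[K] V) (ω : V [⋀^Fin 2]→ₗ[K] K) : V [⋀^Fin 2]→ₗ[K] K :=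
  ω.compLinearMap p

/-- The `(0,2)`-component of a 2-covector: `ω ∘ (q, q)`. -/
def type02 (p : V →ₗ[K] V) (ω : V [⋀^Fin 2]→ₗ[K] K) : V [⋀^Fin 2]→ₗ[K] K :=
  ω.compLinearMap (q p)

/-- The `(1,1)`-component of a 2-covector: what remains. -/
def type11 (p : V →ₗ[K] V) (ω : V [⋀^Fin 2]→ₗ[K] K) : V [⋀^Fin 2]→ₗ[K] K :=
  ω - type20 p ω - type02 p ω

/-- A 2-covector is of type `(2,0)` iff it factors through `p` in both arguments. -/
def IsType20 (p : V →ₗ[K] V) (ω : V [⋀^Fin 2]→ₗ[K] K) : Prop := ω.compLinearMap p = ω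

/-- A 2-covector is of type `(0,2)` iff it factors through `q` in both arguments. -/
def IsType02 (p : V →ₗ[K] V) (ω : V [⋀^Fin 2]→ₗ[K] K) : Prop := ω.compLinearMap (q p) = ω

/-- A 2-covector is of type `(1,1)` iff it vanishes on `𝔭⁺ × 𝔭⁺` and on `𝔭⁻ × 𝔭⁻`. -/
def IsType11 (p : V →ₗ[K] V) (ω : V [⋀^Fin 2]→ₗ[K] K) : Prop :=
  ω.compLinearMap p = 0 ∧ ω.compLinearMap (q p) = 0

/-- The decomposition `ω = ω^{2,0} + ω^{1,1} + ω^{0,2}`. -/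
theorem type20_add_type11_add_type02 (p : V →ₗ[K] V) (ω : V [⋀^Fin 2]→ₗ[K] K) :
    type20 p ω + type11 p ω + type02 p ω = ω := by
  unfold type11; abel

/-- `compLinearMap` is additive in the alternating map, subtraction version. -/
theorem sub_compLinearMap (ω ω' : V [⋀^Fin 2]→ₗ[K] K) (φ : V →ₗ[K] V) :
    (ω - ω').compLinearMap φ = ω.compLinearMap φ - ω'.compLinearMap φ := by
  ext v
  simp only [AlternatingMap.compLinearMap_apply, AlternatingMap.sub_apply]

/-- The `(2,0)`-component is of type `(2,0)`. -/
theorem isType20_type20 (p : V →ₗ[K] V) (hp : p ∘ₗ p = p) (ω : V [⋀^Fin 2]→ₗ[K] K) :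
    IsType20 p (type20 p ω) := by
  unfold IsType20 type20
  rw [AlternatingMap.compLinearMap_assoc, hp]

/-- The `(0,2)`-component is of type `(0,2)`. -/
theorem isType02_type02 (p : V →ₗ[K] V) (hp : p ∘ₗ p = p) (ω : V [⋀^Fin 2]→ₗ[K] K) :
    IsType02 p (type02 p ω) := by
  unfold IsType02 type02
  rw [AlternatingMap.compLinearMap_assoc, q_comp_q p hp]

/-- The `(1,1)`-component is of type `(1,1)`. -/
theorem isType11_type11 (p : V →ₗ[K] V) (hp : p ∘ₗ p = p) (ω : V [⋀^Fin 2]→ₗ[K] K) :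
    IsType11 p (type11 p ω) := by
  unfold IsType11 type11 type20 type02
  constructor
  · rw [sub_compLinearMap, sub_compLinearMap, AlternatingMap.compLinearMap_assoc,
      AlternatingMap.compLinearMap_assoc, hp, q_comp_p p hp, AlternatingMap.compLinearMap_zero]
    abel
  · rw [sub_compLinearMap, sub_compLinearMap, AlternatingMap.compLinearMap_assoc,
      AlternatingMap.compLinearMap_assoc, q_comp_q p hp, p_comp_q p hp,
      AlternatingMap.compLinearMap_zero]
    abel

/-- A `(1,1)`- or `(0,2)`-covector has zero `(2,0)`-component; a `(2,0)`-covector is its own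
`(2,0)`-component. -/
theorem type20_eq_self (p : V →ₗ[K] V) {ω : V [⋀^Fin 2]→ₗ[K] K} (h : IsType20 p ω) :
    type20 p ω = ω := h

/-- The `(2,0)`-component of a `(1,1)`-covector vanishes. -/
theorem type20_eq_zero_of_isType11 (p : V →ₗ[K] V) {ω : V [⋀^Fin 2]→ₗ[K] K}
    (h : IsType11 p ω) : type20 p ω = 0 := h.1

/-- The `(2,0)`-component of a `(0,2)`-covector vanishes. -/
theorem type20_eq_zero_of_isType02 (p : V →ₗ[K] V) (hp : p ∘ₗ p = p)
    {ω : V [⋀^Fin 2]→ₗ[K] K} (h : IsType02 p ω) : type20 p ω = 0 := by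
  unfold type20
  rw [← h, AlternatingMap.compLinearMap_assoc, q_comp_p p hp, AlternatingMap.compLinearMap_zero]

/-- The `(0,2)`-component of a `(1,1)`-covector vanishes. -/
theorem type02_eq_zero_of_isType11 (p : V →ₗ[K] V) {ω : V [⋀^Fin 2]→ₗ[K] K}
    (h : IsType11 p ω) : type02 p ω = 0 := h.2

/-- The `(0,2)`-component of a `(2,0)`-covector vanishes. -/
theorem type02_eq_zero_of_isType20 (p : V →ₗ[K] V) (hp : p ∘ₗ p = p)
    {ω : V [⋀^Fin 2]→ₗ[K] K} (h : IsType20 p ω) : type02 p ω = 0 := by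
  unfold type02
  rw [← h, AlternatingMap.compLinearMap_assoc, p_comp_q p hp, AlternatingMap.compLinearMap_zero]

/-- The `(2,0)`-component is additive. -/
theorem type20_add (p : V →ₗ[K] V) (ω ω' : V [⋀^Fin 2]→ₗ[K] K) :
    type20 p (ω + ω') = type20 p ω + type20 p ω' :=
  AlternatingMap.add_compLinearMap ω ω' p

/-- The `(0,2)`-component is additive. -/
theorem type02_add (p : V →ₗ[K] V) (ω ω' : V [⋀^Fin 2]→ₗ[K] K) :
    type02 p (ω + ω') = type02 p ω + type02 p ω' :=
  AlternatingMap.add_compLinearMap ω ω' (q p)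

/-- **Uniqueness of the decomposition, `(2,0)`-part.** If `ω = α + β + γ` with `α` of type
`(2,0)`, `β` of type `(1,1)` and `γ` of type `(0,2)`, then `α = type20 p ω`. -/
theorem type20_eq_of_eq_add (p : V →ₗ[K] V) (hp : p ∘ₗ p = p) {ω α β γ : V [⋀^Fin 2]→ₗ[K] K}
    (hα : IsType20 p α) (hβ : IsType11 p β) (hγ : IsType02 p γ) (h : ω = α + β + γ) :
    type20 p ω = α := by
  rw [h, type20_add, type20_add, type20_eq_self p hα, type20_eq_zero_of_isType11 p hβ,
    type20_eq_zero_of_isType02 p hp hγ, add_zero, add_zero]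

/-- **Uniqueness of the decomposition, `(0,2)`-part.** -/
theorem type02_eq_of_eq_add (p : V →ₗ[K] V) (hp : p ∘ₗ p = p) {ω α β γ : V [⋀^Fin 2]→ₗ[K] K}
    (hα : IsType20 p α) (hβ : IsType11 p β) (hγ : IsType02 p γ) (h : ω = α + β + γ) :
    type02 p ω = γ := by
  rw [h, type02_add, type02_add, type02_eq_zero_of_isType20 p hp hα,
    type02_eq_zero_of_isType11 p hβ, zero_add, zero_add]
  exact hγ

/-- **Uniqueness of the decomposition, `(1,1)`-part.** -/
theorem type11_eq_of_eq_add (p : V →ₗ[K] V) (hp : p ∘ₗ p = p) {ω α β γ : V [⋀^Fin 2]→ₗ[K] K}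
    (hα : IsType20 p α) (hβ : IsType11 p β) (hγ : IsType02 p γ) (h : ω = α + β + γ) :
    type11 p ω = β := by
  unfold type11
  rw [type20_eq_of_eq_add p hp hα hβ hγ h, type02_eq_of_eq_add p hp hα hβ hγ h, h]
  abel

/-! ## §4 Types add under the wedge -/

/-- **Two `(1,0)`-covectors wedge to a `(2,0)`-covector.** -/
theorem wedge_isType20 (p : V →ₗ[K] V) {f g : V →ₗ[K] K} (hf : IsType10 p f)
    (hg : IsType10 p g) : IsType20 p (wedge f g) := by
  unfold IsType20
  rw [← T5TopFormCharacter.wedge_comp]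
  unfold IsType10 at hf hg
  rw [hf, hg]

/-- **Two `(0,1)`-covectors wedge to a `(0,2)`-covector.** -/
theorem wedge_isType02 (p : V →ₗ[K] V) {f g : V →ₗ[K] K} (hf : IsType01 p f)
    (hg : IsType01 p g) : IsType02 p (wedge f g) := by
  unfold IsType02
  rw [← T5TopFormCharacter.wedge_comp]
  unfold IsType01 at hf hg
  rw [hf, hg]

/-- `wedge f 0 = 0`. -/
theorem wedge_zero_right (f : V →ₗ[K] K) : wedge f (0 : V →ₗ[K] K) = 0 := by
  ext v
  simp only [wedge_apply, LinearMap.zero_apply, mul_zero, sub_self, AlternatingMap.zero_apply]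

/-- **A `(1,0)`-covector and a `(0,1)`-covector wedge to a `(1,1)`-covector.** -/
theorem wedge_isType11 (p : V →ₗ[K] V) (hp : p ∘ₗ p = p) {f g : V →ₗ[K] K}
    (hf : IsType10 p f) (hg : IsType01 p g) : IsType11 p (wedge f g) := by
  unfold IsType11
  unfold IsType10 at hf
  unfold IsType01 at hg
  constructor
  · rw [← T5TopFormCharacter.wedge_comp, hf, ← hg, LinearMap.comp_assoc, q_comp_p p hp,
      LinearMap.comp_zero, wedge_zero_right]
  · rw [← T5TopFormCharacter.wedge_comp, hg, ← hf, LinearMap.comp_assoc, p_comp_q p hp,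
      LinearMap.comp_zero]
    ext v
    simp only [wedge_apply, LinearMap.zero_apply, zero_mul, sub_self, AlternatingMap.zero_apply]

/-! ## §5 `(2,0)`-covectors in coordinates -/

/-- A 2-covector is of type `(2,0)` iff its value on every pair is its value on the
projections to `𝔭⁺`. -/
theorem isType20_iff_forall (p : V →ₗ[K] V) (ω : V [⋀^Fin 2]→ₗ[K] K) :
    IsType20 p ω ↔ ∀ v : Fin 2 → V, ω (fun i => p (v i)) = ω v := by
  unfold IsType20
  constructor
  · intro h v
    have := congrArg (fun ω' : V [⋀^Fin 2]→ₗ[K] K => ω' v) h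
    simpa only [AlternatingMap.compLinearMap_apply] using this
  · intro h
    ext v
    simp only [AlternatingMap.compLinearMap_apply]
    exact h v

/-- A `(2,0)`-covector vanishes as soon as one argument lies in `𝔭⁻`. -/
theorem IsType20.apply_eq_zero_of_mem_range_q (p : V →ₗ[K] V) (hp : p ∘ₗ p = p)
    {ω : V [⋀^Fin 2]→ₗ[K] K} (h : IsType20 p ω) (v : Fin 2 → V) (i : Fin 2)
    (hv : v i ∈ LinearMap.range (q p)) : ω v = 0 := by
  rw [← (isType20_iff_forall p ω).mp h v]
  apply AlternatingMap.map_coord_zero ω i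
  exact p_apply_eq_zero_of_mem_range_q p hp hv

end Summit.Ventures.HodgeRepro2.T5HodgeTypeCovectors
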